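import Summits.Ventures.HodgeRepro2.T6NAut
import Summits.Ventures.HodgeRepro2.T6N3Assembly
import Summits.Ventures.HodgeRepro2.T6N3Bridge
import Summits.Ventures.HodgeRepro2.T6N3Mult

/-!
# T6N3Main — the N3 mains of the M2 composition contract (TARGET-T6 v0.4 §9.3) over `(P : NDatum F) (M : NAut F P)`

Cell pub-hodge-repro2, Tier 6 (README §10), seat t6-p3 (N3 owner, M2). Proof lane. The three theorems
are the N3 field statements of the Tier-5 spine (`T5Assembly.AssemblyCore`: N3A, N3B, N3iso) in the
lead's shapes (STATUS l. 4691 / l. 4925): `N3A_main : M.iA → M.iiA → M.ellA`, `N3B_main : M.iB → M.iiB →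
M.ellB`, `N3iso_main : M.ellA → M.ellB → ∃ c, P.AdmChoice c ∧ M.pairing c ≠ 0`, each consuming its
displays BY NAME (T6N3Hyp: Gan–Takeda 2016 Thm 1.2 / (HD) on a family of local shapes for the sides;
Rogawski 1990 §14.6 partition / Thm 14.6.4 / Thm 14.6.5 on a packet carrier for the assembly) through
the dictionary binders of T6N3Bridge (class AD), the kernel theorems of T6N3Assembly / T6N3Mult, the
fields of `M` (`d3`, `data`, `data_surj`), and the remaining interface Props of T6N3Interface as
declared residual binders (class AD, TARGET-T6 §9.5; each named with its record step in
T6N3Interface). Nothing else is assumed.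

§8(d): uses an L-value-free non-vanishing device: NO.
-/

namespace Summit.Ventures.HodgeRepro2.T6.N3Main

open scoped InnerProductSpace

variable {K : Type*} [Field K] [NumberField K] {F : FaceSetting K} {P : NDatum F} (M : NAut F P)

/-- N3A (Proposition N*, side A): `(i) ∧ (ii) ⟹ ℓ_A^σ ≢ 0 on σ^τ`. Displays consumed by name: Gan–Takeda
2016 Theorem 1.2 / (HD) at the non-archimedean places (`hHD`, on the local shapes `L`), through the
dictionary `hHDbr` (T6N3Bridge, class AD). Residual binders (class AD, T6N3Interface): the remaining
eighteen interface Props of side A. -/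
theorem N3A_main {ι : Type} (L : ι → HoweDualityShape)
    (hHD : ∀ v, Hyp.GanTakeda2016_Thm1_2 (L v)) (hHDbr : M.d3.HoweDualityBridge L M.d3.A)
    (hKC : M.d3.A.KliftCont) (hSeam : M.d3.A.Seam hKC) (hAdj : M.d3.A.Adjoint)
    (hKL : M.d3.A.KliftLevel) (hΘτ : M.d3.A.ThetaTauType M.d3.τiso)
    (hE : M.d3.A.CopiesEquivariant) (hO : M.d3.A.CopiesOrthogonal) (hIncl : M.d3.A.CopiesIncl)
    (hTau : M.d3.A.CopiesTauType) (hDec : M.d3.A.TauTypeDecomposes) (hF : M.d3.A.LevelPartFinite)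
    (hC : M.d3.A.LevelPartCont) (hAvg : M.d3.A.KAverage) (hEq : M.d3.A.ThetaEquivariant)
    (hSpan : M.d3.A.SpanOfFixedVector) (hCO : M.d3.A.CrossCopyOrthogonal)
    (hInd : M.d3.A.CopyIndependence) (hTS : M.d3.A.TensorsSpan) :
    M.iA → M.iiA → M.ellA :=
  M.d3.N3A_of_datum hKC hSeam hAdj hKL (hHDbr hHD).1 (hHDbr hHD).2 hΘτ hE hO hIncl hTau hDec hF hC
    hAvg hEq hSpan hCO hInd hTS

/-- N3B (Proposition N*, side B): the same statement on the side `W₃₄` / `π₀′`. -/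
theorem N3B_main {ι : Type} (L : ι → HoweDualityShape)
    (hHD : ∀ v, Hyp.GanTakeda2016_Thm1_2 (L v)) (hHDbr : M.d3.HoweDualityBridge L M.d3.B)
    (hKC : M.d3.B.KliftCont) (hSeam : M.d3.B.Seam hKC) (hAdj : M.d3.B.Adjoint)
    (hKL : M.d3.B.KliftLevel) (hΘτ : M.d3.B.ThetaTauType M.d3.τiso)
    (hE : M.d3.B.CopiesEquivariant) (hO : M.d3.B.CopiesOrthogonal) (hIncl : M.d3.B.CopiesIncl)
    (hTau : M.d3.B.CopiesTauType) (hDec : M.d3.B.TauTypeDecomposes) (hF : M.d3.B.LevelPartFinite)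
    (hC : M.d3.B.LevelPartCont) (hAvg : M.d3.B.KAverage) (hEq : M.d3.B.ThetaEquivariant)
    (hSpan : M.d3.B.SpanOfFixedVector) (hCO : M.d3.B.CrossCopyOrthogonal)
    (hInd : M.d3.B.CopyIndependence) (hTS : M.d3.B.TensorsSpan) :
    M.iB → M.iiB → M.ellB :=
  M.d3.N3B_of_datum hKC hSeam hAdj hKL (hHDbr hHD).1 (hHDbr hHD).2 hΘτ hE hO hIncl hTau hDec hF hC
    hAvg hEq hSpan hCO hInd hTS

/-- N3iso (N3.L8, the assembly): `ℓ_A^σ ≢ 0 ∧ ℓ_B^σ ≢ 0 ⟹ ∃ c admissible, ⟨F_A, F_B⟩_c ≠ 0`. Displays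
consumed by name: Rogawski 1990 §14.6 (the partition sentence, Theorem 14.6.4, Theorem 14.6.5) on the
packet carrier `R` — giving `m ≤ 1` on `U(V)` through `multLeOne_of_displays` with the Π_s binder `hs`
(the record's residual [G-N3-3], class AD) — and the dictionary `hRbr` (T6N3Bridge, class AD) to the
non-isomorphism of the τ-parts. Residual binders (class AD, T6N3Interface): `hO`, `hst`, `hsimp`,
`hPX`, `hPeqX`, `hPY`, `hPeqY`, `hσX`, and `hσ : Θ_V(π₀′) = σ` (N3 side B under (H_χ)). The admissible
choice `c` is produced by the lead's `NAut.exists_choice_of_pairing_ne_zero` (through `data_surj`,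
compat class IR) from the four Schwartz data of the assembly. -/
theorem N3iso_main (R : RogawskiPackets) (hR0 : Hyp.Rogawski1990_Sec14_6_Partition R)
    (hR1 : Hyp.Rogawski1990_Thm14_6_4 R) (hR2 : Hyp.Rogawski1990_Thm14_6_5 R)
    (hs : ∀ P' ∈ R.Ps, ∀ π, R.mem π P' → R.m π ≤ 1)
    (hst : M.d3.AutStable) (hRbr : M.d3.RogawskiBridge R hst) (hO : M.d3.AutOrthogonal)
    (hsimp : M.d3.AutSimple) (hPX : M.d3.ProductsIn20 M.d3.A) (hPeqX : M.d3.ProductEquivariant M.d3.A)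
    (hPY : M.d3.ProductsIn20 M.d3.B) (hPeqY : M.d3.ProductEquivariant M.d3.B)
    (hσX : M.d3.SigmaIsAut M.d3.A) (hσ : M.d3.B.σ = M.d3.A.σ) :
    M.ellA → M.ellB → ∃ c, P.AdmChoice c ∧ M.pairing c ≠ 0 := by
  intro hA hB
  have hnon : M.d3.AutNonIso hst := hRbr (R.multLeOne_of_displays hR0 hR1 hR2 hs)
  exact M.exists_choice_of_pairing_ne_zero
    (M.d3.N3iso_of_datum hO hst hsimp hnon hPX hPeqX hPY hPeqY hσX hσ hA hB)

end Summit.Ventures.HodgeRepro2.T6.N3Main
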